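import Mathlib
import Literature.NumberTheory.LFunctions.WeilExplicitBombieriLipschitz
import Literature.NumberTheory.LFunctions.ZetaZeroReciprocalSum
import Literature.Analysis.SpecialFunctions.DigammaVerticalAsymptotics
import Literature.Analysis.SpecialFunctions.DigammaVerticalSeries
import Literature.Analysis.SpecialFunctions.LogOnePlusSqIntegral
import HarnessLib

/-!
# The Guinand–Weil explicit formula for `C²` compactly supported test functions

Helper file 1/3 for item stmt-RiemannHypothesis-24919 `ZetaIntegerPrimeConsistent` (route
`DensityLadder`, LINE L57 «sieve sight above the density line», K2 = port of the smoothed explicit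
formula, Iwaniec–Kowalski Thm. 5.12 / Bombieri 2000 Thm. 2).

The tree proves the explicit formula in Bombieri's form for continuous, compactly supported,
Lipschitz `g` whose zero side converges absolutely and whose archimedean integrand is integrable
(`Literature.NumberTheory.LFunctions.tsum_zeroSide_eq_bombieri`).  Here the three analytic
hypotheses are discharged for `g ∈ C²` with compact support: two integrations by parts give
`‖ĝ(s)‖ ≪ 1/(1 + (Im s)²)` on vertical strips, whence `Σ_ρ ‖m(ρ)ĝ(ρ)‖ < ∞` by
`Σ_ρ m(ρ)/(1+γ²) < ∞` (`ZetaZeroSum.summable_zeroOrder_div_one_add_sq`) and the integrability of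
`ĝ(1/2+it) Re ψ(1/4+it/2)` by `Re ψ(1/4+it/2) = log(1+|t|/2) + O(1)`.
Cell rh-split, seat rh-split-prover-l57 g0.  RH-free.  Nothing here bears on the truth of RH.
-/

set_option linter.dupNamespace false

noncomputable section

open Complex Filter Set MeasureTheory Topology
open scoped Real ComplexConjugate

namespace Summit.RiemannHypothesis.RiemannHypothesis.Theorems.DensityLadderExplicitFormulaC2

open Literature.NumberTheory.LFunctions

/-! ## Integration by parts for `C¹` / `C²` test functions -/

section IBP

variable {g : ℝ → ℂ}

/-- Integration by parts for a `C¹` compactly supported test function: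
`(g')^(s) = -(s - 1/2) ĝ(s)` (the tree's `weilMellin_deriv` assumes `C^∞`; the proof is the same).
[folklore] -/
theorem weilMellin_deriv_of_contDiff_one (hg : ContDiff ℝ 1 g) (hgs : HasCompactSupport g)
    (s : ℂ) : weilMellin (deriv g) s = -(s - 1 / 2) * weilMellin g s := by
  unfold weilMellin
  have hgc : Continuous g := hg.continuous
  have hdc : Continuous (deriv g) := hg.continuous_deriv le_rfl
  have hds : HasCompactSupport (deriv g) := hgs.deriv
  set w : ℂ := s - 1 / 2 with hw
  have hu : ∀ t : ℝ, HasDerivAt (fun t : ℝ ↦ cexp (w * t)) (w * cexp (w * t)) t := by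
    intro t
    have h1 : HasDerivAt (fun t : ℝ ↦ w * (t : ℂ)) (w * 1) t :=
      (Complex.ofRealCLM.hasDerivAt.const_mul w).congr_deriv (by simp)
    have h2 := (Complex.hasDerivAt_exp (w * t)).comp t h1
    simpa [mul_comm, Function.comp_def] using h2
  have hv : ∀ t : ℝ, HasDerivAt g (deriv g t) t := fun t ↦
    (hg.differentiable one_ne_zero t).hasDerivAt
  have key := integral_mul_deriv_eq_deriv_mul_of_integrable (u := fun t : ℝ ↦ cexp (w * t))
    (u' := fun t : ℝ ↦ w * cexp (w * t)) (v := g) (v' := deriv g)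
    (fun t _ ↦ hu t) (fun t _ ↦ hv t) ?_ ?_ ?_
  · calc ∫ t : ℝ, deriv g t * cexp (w * t) = ∫ t : ℝ, cexp (w * t) * deriv g t := by
          congr 1 with t; ring
      _ = -∫ t : ℝ, w * cexp (w * t) * g t := key
      _ = -w * ∫ t : ℝ, g t * cexp (w * t) := by
          rw [neg_mul, ← integral_const_mul]
          congr 2 with t; ring
  · have := integrable_weilIntegrand hdc hds s
    rw [← hw] at this
    exact this.congr (Eventually.of_forall fun t ↦ by simp [mul_comm])
  · have := (integrable_weilIntegrand hgc hgs s).const_mul w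
    rw [← hw] at this
    exact this.congr (Eventually.of_forall fun t ↦ by simp [Pi.mul_apply]; ring)
  · have := integrable_weilIntegrand hgc hgs s
    rw [← hw] at this
    exact this.congr (Eventually.of_forall fun t ↦ by simp [mul_comm])

/-- Twice, for a `C²` compactly supported test function: `(g'')^(s) = (s - 1/2)² ĝ(s)`. [folklore] -/
theorem weilMellin_deriv_deriv_of_contDiff_two (hg : ContDiff ℝ 2 g) (hgs : HasCompactSupport g)
    (s : ℂ) : weilMellin (deriv (deriv g)) s = (s - 1 / 2) ^ 2 * weilMellin g s := by
  have h1 : ContDiff ℝ 1 (deriv g) := hg.deriv'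
  rw [weilMellin_deriv_of_contDiff_one h1 hgs.deriv,
    weilMellin_deriv_of_contDiff_one (hg.of_le (by norm_num)) hgs]
  ring

/-- **Decay of `ĝ` for a `C²` compactly supported test function** on the strip `|Re s - 1/2| ≤ A`:
`‖ĝ(s)‖ ≤ (∫‖g‖e^{A|t|} + ∫‖g''‖e^{A|t|}) / (1 + (Im s)²)` (two integrations by parts).
[folklore] -/
theorem norm_weilMellin_le_of_contDiff_two (hg : ContDiff ℝ 2 g) (hgs : HasCompactSupport g)
    {A : ℝ} {s : ℂ} (hs : |s.re - 1 / 2| ≤ A) :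
    ‖weilMellin g s‖ ≤ (weilL1W A g + weilL1W A (deriv (deriv g))) / (1 + s.im ^ 2) := by
  have hpos : 0 < 1 + s.im ^ 2 := by positivity
  rw [le_div_iff₀ hpos]
  have hgc : Continuous g := hg.continuous
  have h2c : Continuous (deriv (deriv g)) := by
    have h1 : ContDiff ℝ 1 (deriv g) := hg.deriv'
    exact h1.continuous_deriv le_rfl
  have h1 : ‖weilMellin g s‖ ≤ weilL1W A g := norm_weilMellin_le_weilL1W hgc hgs hs
  have h2 : ‖weilMellin (deriv (deriv g)) s‖ ≤ weilL1W A (deriv (deriv g)) :=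
    norm_weilMellin_le_weilL1W h2c hgs.deriv.deriv hs
  rw [weilMellin_deriv_deriv_of_contDiff_two hg hgs, norm_mul, norm_pow] at h2
  have h3 : s.im ^ 2 ≤ ‖s - 1 / 2‖ ^ 2 := by
    have : |s.im| ≤ ‖s - 1 / 2‖ := by
      have h := Complex.abs_im_le_norm (s - 1 / 2)
      simpa using h
    nlinarith [abs_nonneg s.im, sq_abs s.im]
  have h4 : 0 ≤ ‖weilMellin g s‖ := norm_nonneg _
  nlinarith

end IBP

/-! ## Zero side and archimedean side for `C²` test functions -/

section ZeroArch

variable {g : ℝ → ℂ}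

/-- **Absolute convergence of the zero side for a `C²` compactly supported test function**:
`Σ_ρ ‖m(ρ) ĝ(ρ)‖ < ∞` over the non-trivial zeros (decay `‖ĝ(ρ)‖ ≪ 1/(1+γ²)` by two integrations by
parts and `Σ_ρ m(ρ)/(1+γ²) < ∞`, `summable_zeroOrder_div_one_add_sq`). [folklore] -/
theorem summable_norm_zeroSide_of_contDiff_two (hg : ContDiff ℝ 2 g) (hgs : HasCompactSupport g) :
    Summable fun ρ : ZetaZeros.riemannZetaNontrivialZeros ↦
      ‖(riemannZetaZeroOrder (ρ : ℂ) : ℂ) * weilMellin g ρ‖ := by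
  set D : ℝ := weilL1W (1 / 2) g + weilL1W (1 / 2) (deriv (deriv g)) with hD
  have hsum : Summable fun ρ : ZetaZeros.riemannZetaNontrivialZeros ↦
      D * ((riemannZetaZeroOrder (ρ : ℂ) : ℝ) / (1 + (ρ : ℂ).im ^ 2)) :=
    (ZetaZeroSum.summable_zeroOrder_div_one_add_sq).mul_left D
  refine Summable.of_nonneg_of_le (fun _ ↦ norm_nonneg _) (fun ρ ↦ ?_) hsum
  have hρ := ρ.2
  have h0 := ZetaZeros.riemannZetaNontrivialZeros.re_pos hρ
  have h1 := ZetaZeros.riemannZetaNontrivialZeros.re_lt_one hρ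
  have hm : (0 : ℝ) ≤ riemannZetaZeroOrder (ρ : ℂ) := by
    exact_mod_cast riemannZetaZeroOrder_nonneg (ZetaZeros.riemannZetaNontrivialZeros.ne_one hρ)
  have hdec : ‖weilMellin g ρ‖ ≤ D / (1 + (ρ : ℂ).im ^ 2) :=
    norm_weilMellin_le_of_contDiff_two hg hgs (abs_le.2 ⟨by linarith, by linarith⟩)
  rw [norm_mul, Complex.norm_intCast, abs_of_nonneg hm]
  calc (riemannZetaZeroOrder (ρ : ℂ) : ℝ) * ‖weilMellin g ρ‖
      ≤ (riemannZetaZeroOrder (ρ : ℂ) : ℝ) * (D / (1 + (ρ : ℂ).im ^ 2)) :=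
        mul_le_mul_of_nonneg_left hdec hm
    _ = D * ((riemannZetaZeroOrder (ρ : ℂ) : ℝ) / (1 + (ρ : ℂ).im ^ 2)) := by ring

/-- **Integrability of the archimedean integrand for a `C²` compactly supported test function**:
`t ↦ ĝ(1/2 + it) Re ψ(1/4 + it/2)` is integrable (`‖ĝ(1/2+it)‖ ≪ 1/(1+t²)` and
`Re ψ(1/4+it/2) = log(1+|t|/2) + O(1)`). [folklore] -/
theorem integrable_archIntegrand_of_contDiff_two (hg : ContDiff ℝ 2 g) (hgs : HasCompactSupport g) :
    Integrable fun t : ℝ ↦ weilMellin g (1 / 2 + t * I) *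
      ((Complex.digamma (1 / 4 + t / 2 * I)).re : ℂ) := by
  obtain ⟨C, hC⟩ :=
    Literature.Analysis.SpecialFunctions.Complex.exists_norm_digamma_sub_log_le_of_pos
      (a := 1 / 4) (by norm_num)
  set D : ℝ := weilL1W 0 g + weilL1W 0 (deriv (deriv g)) with hD
  have hD0 : 0 ≤ D := add_nonneg (weilL1W_nonneg _ _) (weilL1W_nonneg _ _)
  have hC0 : 0 ≤ C := le_trans (norm_nonneg _) (hC 0)
  -- continuity
  have hgc : Continuous g := hg.continuous
  have hc1 : Continuous fun t : ℝ ↦ weilMellin g (1 / 2 + t * I) := by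
    have := continuous_weilMellin_vertical hgc hgs (1 / 2)
    refine this.congr fun t ↦ ?_
    push_cast; ring_nf
  have hc2 : Continuous fun t : ℝ ↦ ((Complex.digamma (1 / 4 + t / 2 * I)).re : ℂ) :=
    Complex.continuous_ofReal.comp Literature.Analysis.SpecialFunctions.continuous_reDigammaQuarter
  -- the majorant
  have hmaj : Integrable fun t : ℝ ↦
      D * ((C + Real.log 2) * (1 + t ^ 2)⁻¹ + Real.log (1 + t ^ 2) / (1 + t ^ 2)) :=
    ((integrable_inv_one_add_sq.const_mul _).add
      Literature.Analysis.SpecialFunctions.integrable_log_one_add_sq_div).const_mul D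
  refine Integrable.mono' hmaj (hc1.mul hc2).aestronglyMeasurable (Eventually.of_forall fun t ↦ ?_)
  have hpos : 0 < 1 + t ^ 2 := by positivity
  -- decay of ĝ on the critical line
  have hdec : ‖weilMellin g (1 / 2 + t * I)‖ ≤ D / (1 + t ^ 2) := by
    have h := norm_weilMellin_le_of_contDiff_two hg hgs (A := 0) (s := 1 / 2 + t * I) (by simp)
    simpa using h
  -- size of Re ψ(1/4 + it/2)
  have hψ : |(Complex.digamma (1 / 4 + t / 2 * I)).re| ≤ Real.log (1 + |t / 2|) + C := by
    have h := hC (t / 2)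
    have e : ((1 / 4 : ℝ) : ℂ) + ((t / 2 : ℝ) : ℂ) * I = 1 / 4 + t / 2 * I := by push_cast; ring
    rw [e] at h
    have hre := (Complex.abs_re_le_norm
      (Complex.digamma (1 / 4 + t / 2 * I) - (Real.log (1 + |t / 2|) : ℂ))).trans h
    rw [Complex.sub_re, Complex.ofReal_re] at hre
    have hL : 0 ≤ Real.log (1 + |t / 2|) := Real.log_nonneg (by linarith [abs_nonneg (t / 2)])
    rw [abs_le] at hre ⊢
    constructor <;> linarith [hre.1, hre.2]
  have hlog : Real.log (1 + |t / 2|) ≤ Real.log 2 + Real.log (1 + t ^ 2) := by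
    rw [← Real.log_mul (by norm_num) (by positivity)]
    refine Real.log_le_log (by positivity) ?_
    rw [abs_div, abs_two]
    nlinarith [abs_nonneg t, sq_abs t, sq_nonneg (|t| - 1)]
  rw [norm_mul, Complex.norm_real, Real.norm_eq_abs]
  have hL2 : 0 ≤ Real.log (1 + t ^ 2) := Real.log_nonneg (by nlinarith [sq_nonneg t])
  calc ‖weilMellin g (1 / 2 + t * I)‖ * |(Complex.digamma (1 / 4 + t / 2 * I)).re|
      ≤ (D / (1 + t ^ 2)) * (Real.log 2 + Real.log (1 + t ^ 2) + C) :=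
        mul_le_mul hdec (hψ.trans (by linarith)) (abs_nonneg _) (by positivity)
    _ = D * ((C + Real.log 2) * (1 + t ^ 2)⁻¹ + Real.log (1 + t ^ 2) / (1 + t ^ 2)) := by
        field_simp
        ring

end ZeroArch

/-! ## The explicit formula for `C²` test functions -/

section Explicit

variable {g : ℝ → ℂ}

/-- **The Guinand–Weil explicit formula (Bombieri's form) for a `C²` compactly supported test
function**: `Σ'_ρ m(ρ) ĝ(ρ) = ĝ(0) + ĝ(1) − Σ_n Λ(n) n^{-1/2}(g(log n) + g(−log n)) + W_∞^B(g)`,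
the zero side converging absolutely (tree: `tsum_zeroSide_eq_bombieri`, with the Lipschitz,
summability and integrability hypotheses discharged for `C²`). [cite: Bombieri2000Weil, Thm. 2 p. 186] -/
theorem tsum_zeroSide_eq_bombieri_of_contDiff_two (hg : ContDiff ℝ 2 g)
    (hgs : HasCompactSupport g) :
    ∑' ρ : ZetaZeros.riemannZetaNontrivialZeros,
        (riemannZetaZeroOrder (ρ : ℂ) : ℂ) * weilMellin g ρ =
      weilPolarTerm g - weilPrimeTerm g + weilArchTermBombieri g := by
  obtain ⟨L, hL⟩ := hg.lipschitzWith_of_hasCompactSupport hgs (by norm_num)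
  exact tsum_zeroSide_eq_bombieri hg.continuous hgs hL
    (summable_norm_zeroSide_of_contDiff_two hg hgs) (integrable_archIntegrand_of_contDiff_two hg hgs)

end Explicit

end Summit.RiemannHypothesis.RiemannHypothesis.Theorems.DensityLadderExplicitFormulaC2

end
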